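import Summits.Ventures.LatticeQCDFlow.Scoring.U1PlaquetteCharFunWindow
import Summits.Ventures.LatticeQCDFlow.Scoring.TorusPartitionFunctionContinuumLimit
import Mathlib.Analysis.SpecialFunctions.Gaussian.FourierTransform
import HarnessLib

/-!
# Local central limit theorem for the plaquette-angle sum: `∫ e^{−2πikt} φ_{β_j}(t)^{V_j} dt → √(2π/v) e^{−2π²k²/v}`

HONEST FRAMING: exact (Metropolis-corrected) sampling algorithms for lattice gauge theory;
figures of merit are autocorrelation/cost numbers at stated couplings and volumes; no
continuum-physics claim.

Venture `LatticeQCDFlow` (cell pub-lqcd), sub-topic `Scoring`; FANOUT row 5 (`s0-sun-a`), GEN-15.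
NEW WORK of the cell (placement rule).  With the one-plaquette characteristic function
`φ_β(t) = ∫_{−π}^{π} cos(tx) e^{β cos x} dx / ∫_{−π}^{π} e^{β cos x} dx`
(`Scoring/U1PlaquetteCharFunBounds.lean`, `Scoring/U1PlaquetteCharFunWindow.lean`) and any
sequences `β_j → ∞`, `V_j ∈ ℕ` with `V_j/β_j → v > 0`:

* **`tendsto_charFun_pow`** — `φ_{β_j}(t)^{V_j} → e^{−v t²/2}` for every real `t` (Taylor sandwich
  `1 − t² m₂/2 ≤ φ ≤ 1 − t² m₂/2 + t⁴ m₄/24`, `V m₂ → v`, `V m₄ → 0` from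
  `Scoring/PlaquetteAngleSecondMomentWeakCoupling.lean`, and `e^{V(1 − 1/(1−a))} ≤ (1−a)^V`,
  `(1−c)^V ≤ e^{−Vc}`);
* **`abs_charFun_pow_le_majorant`** — eventually in `j`, for all `t`:
  `|φ_{β_j}(t)|^{V_j} ≤ e^{−(κv/2) t²} + 5B/(1+t²)` (window bound for `|t| ≤ 2√β_j`, tail bound
  beyond; `β (3/5)^V ≤ B = e^{−1}/((v/2) log(5/3))`) — an integrable majorant;
* **`tendsto_integral_cexp_mul_charFun_pow`** — by dominated convergence,
  `∫_ℝ e^{−it·2πk} φ_{β_j}(t)^{V_j} dt → ∫_ℝ e^{−it·2πk} e^{−vt²/2} dt`, and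
  **`integral_cexp_mul_gaussian_eq`** — the latter is `√(2π/v) e^{−2π²k²/v}` (Mathlib's Gaussian
  Fourier transform).

This is the analytic core of the continuum limit of the topological-charge law
(`Scoring/U1TorusTopologicalChargeContinuumLimit.lean`).  Elementary given the parents; nothing is
cited.  No sampler values.
-/

noncomputable section

open Real MeasureTheory Set Filter Topology intervalIntegral Complex
open Literature.Analysis.FunctionSpaces

namespace Summit.Ventures.LatticeQCDFlow.Scoring

/-! ### 1. Moments along the sequence and the Taylor sandwich in quotient form -/

/-- `1 − (t²/2) m₂(β) ≤ φ_β(t)`. -/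
theorem one_sub_le_charFun (β t : ℝ) :
    1 - t ^ 2 / 2 * ((∫ x in (-π)..π, x ^ 2 * Real.exp (β * Real.cos x)) /
        (∫ x in (-π)..π, Real.exp (β * Real.cos x))) ≤
      (∫ x in (-π)..π, Real.cos (t * x) * Real.exp (β * Real.cos x)) /
        (∫ x in (-π)..π, Real.exp (β * Real.cos x)) := by
  have hZ := integral_exp_mul_cos_neg_pi_pi_pos β
  have h := integral_cos_mul_mul_exp_ge β t
  rw [le_div_iff₀ hZ]
  have e : (1 - t ^ 2 / 2 * ((∫ x in (-π)..π, x ^ 2 * Real.exp (β * Real.cos x)) /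
      (∫ x in (-π)..π, Real.exp (β * Real.cos x)))) * (∫ x in (-π)..π, Real.exp (β * Real.cos x)) =
      (∫ x in (-π)..π, Real.exp (β * Real.cos x)) -
        t ^ 2 / 2 * ∫ x in (-π)..π, x ^ 2 * Real.exp (β * Real.cos x) := by
    field_simp
  rw [e]
  exact h

/-- `φ_β(t) ≤ 1 − (t²/2) m₂(β) + (t⁴/24) m₄(β)`. -/
theorem charFun_le_one_sub_add (β t : ℝ) :
    (∫ x in (-π)..π, Real.cos (t * x) * Real.exp (β * Real.cos x)) /
        (∫ x in (-π)..π, Real.exp (β * Real.cos x)) ≤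
      1 - t ^ 2 / 2 * ((∫ x in (-π)..π, x ^ 2 * Real.exp (β * Real.cos x)) /
        (∫ x in (-π)..π, Real.exp (β * Real.cos x))) +
        t ^ 4 / 24 * ((∫ x in (-π)..π, x ^ 4 * Real.exp (β * Real.cos x)) /
          (∫ x in (-π)..π, Real.exp (β * Real.cos x))) := by
  have hZ := integral_exp_mul_cos_neg_pi_pi_pos β
  have h := integral_cos_mul_mul_exp_le β t
  rw [div_le_iff₀ hZ]
  have e : (1 - t ^ 2 / 2 * ((∫ x in (-π)..π, x ^ 2 * Real.exp (β * Real.cos x)) /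
      (∫ x in (-π)..π, Real.exp (β * Real.cos x))) +
      t ^ 4 / 24 * ((∫ x in (-π)..π, x ^ 4 * Real.exp (β * Real.cos x)) /
        (∫ x in (-π)..π, Real.exp (β * Real.cos x)))) * (∫ x in (-π)..π, Real.exp (β * Real.cos x)) =
      (∫ x in (-π)..π, Real.exp (β * Real.cos x)) -
        t ^ 2 / 2 * (∫ x in (-π)..π, x ^ 2 * Real.exp (β * Real.cos x)) +
        t ^ 4 / 24 * ∫ x in (-π)..π, x ^ 4 * Real.exp (β * Real.cos x) := by
    field_simp
  rw [e]
  exact h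

/-- `V_j · m₂(β_j) → v` (`β m₂(β) → 1` and `V_j/β_j → v`). -/
theorem tendsto_mul_sqMoment {β : ℕ → ℝ} {V : ℕ → ℕ} {v : ℝ} (hβ : Tendsto β atTop atTop)
    (hv : Tendsto (fun j => (V j : ℝ) / β j) atTop (𝓝 v)) :
    Tendsto (fun j => (V j : ℝ) * ((∫ x in (-π)..π, x ^ 2 * Real.exp (β j * Real.cos x)) /
      (∫ x in (-π)..π, Real.exp (β j * Real.cos x)))) atTop (𝓝 v) := by
  have h := hv.mul (tendsto_beta_mul_sqMoment.comp hβ)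
  rw [mul_one] at h
  refine h.congr' ?_
  filter_upwards [hβ.eventually_gt_atTop 0] with j hj
  simp only [Function.comp_def]
  field_simp

/-- `m₂(β_j) → 0`. -/
theorem tendsto_sqMoment_zero {β : ℕ → ℝ} (hβ : Tendsto β atTop atTop) :
    Tendsto (fun j => (∫ x in (-π)..π, x ^ 2 * Real.exp (β j * Real.cos x)) /
      (∫ x in (-π)..π, Real.exp (β j * Real.cos x))) atTop (𝓝 0) := by
  have h := (tendsto_beta_mul_sqMoment.comp hβ).mul (tendsto_inv_atTop_zero.comp hβ)
  rw [one_mul] at h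
  refine h.congr' ?_
  filter_upwards [hβ.eventually_gt_atTop 0] with j hj
  simp only [Function.comp_def]
  field_simp

/-- `V_j · m₄(β_j) → 0` (`m₄ ≤ 3m₂/β + K/(6β³)`). -/
theorem tendsto_mul_fourthMoment {β : ℕ → ℝ} {V : ℕ → ℕ} {v : ℝ} (hβ : Tendsto β atTop atTop)
    (hv : Tendsto (fun j => (V j : ℝ) / β j) atTop (𝓝 v)) :
    Tendsto (fun j => (V j : ℝ) * ((∫ x in (-π)..π, x ^ 4 * Real.exp (β j * Real.cos x)) /
      (∫ x in (-π)..π, Real.exp (β j * Real.cos x)))) atTop (𝓝 0) := by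
  set K := 81 / 5 * Real.exp (-3) * π ^ 7 * Real.sqrt π with hK
  have hinv : Tendsto (fun j => (β j)⁻¹) atTop (𝓝 0) := tendsto_inv_atTop_zero.comp hβ
  have h2 := tendsto_mul_sqMoment hβ hv
  have hup : Tendsto (fun j => 3 * ((V j : ℝ) * ((∫ x in (-π)..π, x ^ 2 * Real.exp (β j * Real.cos x)) /
      (∫ x in (-π)..π, Real.exp (β j * Real.cos x)))) * (β j)⁻¹ +
        K / 6 * ((V j : ℝ) / β j) * (β j)⁻¹ ^ 2) atTop (𝓝 0) := by
    have ha := (h2.const_mul 3).mul hinv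
    have hb := ((hv.const_mul (K / 6)).mul (hinv.pow 2))
    simpa using ha.add hb
  refine tendsto_of_tendsto_of_tendsto_of_le_of_le' tendsto_const_nhds hup ?_ ?_
  · filter_upwards [hβ.eventually_gt_atTop 0] with j hj
    exact mul_nonneg (by positivity) (div_nonneg (intervalIntegral.integral_nonneg
      (by linarith [Real.pi_pos]) fun x _ => by positivity) (integral_exp_mul_cos_neg_pi_pi_pos _).le)
  · filter_upwards [hβ.eventually_ge_atTop 1] with j hj
    have hj0 : 0 < β j := by linarith
    have hZ := integral_exp_mul_cos_neg_pi_pi_pos (β j)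
    have h4 := fourthMoment_le_sqMoment_add_sixthMoment hj0
    have h6 := (div_le_iff₀ hZ).1 (sixthMoment_plaquetteAngle_le hj)
    rw [← hK] at h6
    have hV0 : (0 : ℝ) ≤ V j := by positivity
    set Z := ∫ x in (-π)..π, Real.exp (β j * Real.cos x) with hZd
    set M2 := ∫ x in (-π)..π, x ^ 2 * Real.exp (β j * Real.cos x) with hM2
    set M4 := ∫ x in (-π)..π, x ^ 4 * Real.exp (β j * Real.cos x) with hM4
    set M6 := ∫ x in (-π)..π, x ^ 6 * Real.exp (β j * Real.cos x) with hM6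
    have h4' : M4 / Z ≤ 3 / β j * (M2 / Z) + K / β j ^ 3 / 6 := by
      rw [div_le_iff₀ hZ]
      have e : (3 / β j * (M2 / Z) + K / β j ^ 3 / 6) * Z = 3 / β j * M2 + K / β j ^ 3 * Z / 6 := by
        field_simp
      rw [e]
      linarith
    have := mul_le_mul_of_nonneg_left h4' hV0
    have e2 : (V j : ℝ) * (3 / β j * (M2 / Z) + K / β j ^ 3 / 6) =
        3 * ((V j : ℝ) * (M2 / Z)) * (β j)⁻¹ + K / 6 * ((V j : ℝ) / β j) * (β j)⁻¹ ^ 2 := by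
      field_simp
    linarith

/-- **The pointwise limit `φ_{β_j}(t)^{V_j} → e^{−v t²/2}`** for every real `t`, whenever
`β_j → ∞` and `V_j/β_j → v`. -/
theorem tendsto_charFun_pow {β : ℕ → ℝ} {V : ℕ → ℕ} {v : ℝ} (hβ : Tendsto β atTop atTop)
    (hv : Tendsto (fun j => (V j : ℝ) / β j) atTop (𝓝 v)) (t : ℝ) :
    Tendsto (fun j => ((∫ x in (-π)..π, Real.cos (t * x) * Real.exp (β j * Real.cos x)) /
      (∫ x in (-π)..π, Real.exp (β j * Real.cos x))) ^ V j) atTop (𝓝 (Real.exp (-(v * t ^ 2 / 2)))) := by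
  set m2 : ℕ → ℝ := fun j => (∫ x in (-π)..π, x ^ 2 * Real.exp (β j * Real.cos x)) /
    (∫ x in (-π)..π, Real.exp (β j * Real.cos x)) with hm2
  set m4 : ℕ → ℝ := fun j => (∫ x in (-π)..π, x ^ 4 * Real.exp (β j * Real.cos x)) /
    (∫ x in (-π)..π, Real.exp (β j * Real.cos x)) with hm4
  set φ : ℕ → ℝ := fun j => (∫ x in (-π)..π, Real.cos (t * x) * Real.exp (β j * Real.cos x)) /
    (∫ x in (-π)..π, Real.exp (β j * Real.cos x)) with hφ
  set a : ℕ → ℝ := fun j => t ^ 2 / 2 * m2 j with ha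
  set c : ℕ → ℝ := fun j => t ^ 2 / 2 * m2 j - t ^ 4 / 24 * m4 j with hc
  have hlo_j : ∀ j, 1 - a j ≤ φ j := fun j => one_sub_le_charFun (β j) t
  have hhi_j : ∀ j, φ j ≤ 1 - c j := fun j => by
    have := charFun_le_one_sub_add (β j) t
    simp only [hφ, hc, hm2, hm4]
    linarith
  have hVm2 : Tendsto (fun j => (V j : ℝ) * m2 j) atTop (𝓝 v) := tendsto_mul_sqMoment hβ hv
  have hVm4 : Tendsto (fun j => (V j : ℝ) * m4 j) atTop (𝓝 0) := tendsto_mul_fourthMoment hβ hv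
  have hm2z : Tendsto m2 atTop (𝓝 0) := tendsto_sqMoment_zero hβ
  have ha0 : Tendsto a atTop (𝓝 0) := by
    simpa [ha] using hm2z.const_mul (t ^ 2 / 2)
  have hVa : Tendsto (fun j => (V j : ℝ) * a j) atTop (𝓝 (v * t ^ 2 / 2)) := by
    have h := hVm2.const_mul (t ^ 2 / 2)
    rw [show t ^ 2 / 2 * v = v * t ^ 2 / 2 by ring] at h
    exact h.congr fun j => by simp only [ha]; ring
  have hVc : Tendsto (fun j => (V j : ℝ) * c j) atTop (𝓝 (v * t ^ 2 / 2)) := by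
    have h := (hVm2.const_mul (t ^ 2 / 2)).sub (hVm4.const_mul (t ^ 4 / 24))
    rw [show t ^ 2 / 2 * v - t ^ 4 / 24 * 0 = v * t ^ 2 / 2 by ring] at h
    exact h.congr fun j => by simp only [hc]; ring
  -- envelopes
  have hlo : Tendsto (fun j => Real.exp ((V j : ℝ) * (1 - (1 - a j)⁻¹))) atTop
      (𝓝 (Real.exp (-(v * t ^ 2 / 2)))) := by
    have h1 : Tendsto (fun j => -((V j : ℝ) * a j) / (1 - a j)) atTop (𝓝 (-(v * t ^ 2 / 2) / (1 - 0))) :=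
      hVa.neg.div (tendsto_const_nhds.sub ha0) (by norm_num)
    rw [sub_zero, div_one] at h1
    refine ((Real.continuous_exp.tendsto _).comp h1).congr' ?_
    filter_upwards [ha0.eventually (eventually_lt_nhds (zero_lt_one' ℝ))] with j hj
    have h1a : (1 - a j) ≠ 0 := by linarith
    simp only [Function.comp_def]
    congr 1
    field_simp
    ring
  have hhi : Tendsto (fun j => Real.exp (-((V j : ℝ) * c j))) atTop (𝓝 (Real.exp (-(v * t ^ 2 / 2)))) :=
    (Real.continuous_exp.tendsto _).comp hVc.neg
  refine tendsto_of_tendsto_of_tendsto_of_le_of_le' hlo hhi ?_ ?_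
  · filter_upwards [ha0.eventually (eventually_lt_nhds (zero_lt_one' ℝ))] with j hja
    have h1a : 0 < 1 - a j := by linarith
    have hexp : Real.exp (1 - (1 - a j)⁻¹) ≤ 1 - a j := by
      calc Real.exp (1 - (1 - a j)⁻¹) ≤ Real.exp (Real.log (1 - a j)) :=
            Real.exp_le_exp.2 (Real.one_sub_inv_le_log_of_pos h1a)
        _ = 1 - a j := Real.exp_log h1a
    calc Real.exp ((V j : ℝ) * (1 - (1 - a j)⁻¹)) = Real.exp (1 - (1 - a j)⁻¹) ^ V j := by
          rw [← Real.exp_nat_mul]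
      _ ≤ (1 - a j) ^ V j := pow_le_pow_left₀ (Real.exp_pos _).le hexp _
      _ ≤ φ j ^ V j := pow_le_pow_left₀ h1a.le (hlo_j j) _
  · filter_upwards [ha0.eventually (eventually_lt_nhds (zero_lt_one' ℝ))] with j hja
    have hφ0 : 0 ≤ φ j := le_trans (by linarith) (hlo_j j)
    have h1c : 0 ≤ 1 - c j := hφ0.trans (hhi_j j)
    calc φ j ^ V j ≤ (1 - c j) ^ V j := pow_le_pow_left₀ hφ0 (hhi_j j) _
      _ ≤ Real.exp (-c j) ^ V j :=
          pow_le_pow_left₀ h1c (by linarith [Real.add_one_le_exp (-c j)]) _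
      _ = Real.exp (-((V j : ℝ) * c j)) := by rw [← Real.exp_nat_mul]; congr 1; ring

/-! ### 2. The integrable majorant -/

/-- `β (3/5)^V ≤ e^{−1}/((v/2) log(5/3))` whenever `(v/2) β ≤ V`, `β ≥ 0`, `v > 0`. -/
theorem mul_pow_three_fifths_le {β v : ℝ} {V : ℕ} (hv : 0 < v) (hβ : 0 ≤ β) (hV : v / 2 * β ≤ V) :
    β * (3 / 5 : ℝ) ^ V ≤ Real.exp (-1) / (v / 2 * Real.log (5 / 3)) := by
  have hlog : 0 < Real.log (5 / 3) := Real.log_pos (by norm_num)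
  set c := v / 2 * Real.log (5 / 3) with hc
  have hc0 : 0 < c := by positivity
  -- `(3/5)^V = exp(−V log(5/3)) ≤ exp(−c β)`
  have h35 : (3 / 5 : ℝ) ^ V = Real.exp (-((V : ℝ) * Real.log (5 / 3))) := by
    have hl : Real.log (3 / 5) = -Real.log (5 / 3) := by
      rw [← Real.log_inv]; norm_num
    rw [show -((V : ℝ) * Real.log (5 / 3)) = V * Real.log (3 / 5) by rw [hl]; ring, Real.exp_nat_mul,
      Real.exp_log (by norm_num)]
  have h1 : β * (3 / 5 : ℝ) ^ V ≤ β * Real.exp (-(c * β)) := by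
    rw [h35]
    refine mul_le_mul_of_nonneg_left (Real.exp_le_exp.2 ?_) hβ
    rw [hc]
    nlinarith [mul_le_mul_of_nonneg_right hV hlog.le]
  refine h1.trans ?_
  -- `β e^{−cβ} ≤ e^{−1}/c`: from `cβ ≤ e^{cβ − 1}`
  have h2 : c * β ≤ Real.exp (c * β - 1) := by linarith [Real.add_one_le_exp (c * β - 1)]
  rw [le_div_iff₀ hc0]
  have hE : Real.exp (c * β - 1) = Real.exp (c * β) * Real.exp (-1) := by
    rw [← Real.exp_add]; ring_nf
  have hinv : Real.exp (-(c * β)) * Real.exp (c * β) = 1 := by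
    rw [← Real.exp_add, neg_add_cancel, Real.exp_zero]
  calc β * Real.exp (-(c * β)) * c = (c * β) * Real.exp (-(c * β)) := by ring
    _ ≤ Real.exp (c * β - 1) * Real.exp (-(c * β)) :=
        mul_le_mul_of_nonneg_right h2 (Real.exp_pos _).le
    _ = Real.exp (-1) := by rw [hE, mul_assoc, mul_comm (Real.exp (-1)), ← mul_assoc, mul_comm (Real.exp (c * β)), hinv, one_mul]

/-- **The majorant**: eventually in `j`, for every `t`,
`|φ_{β_j}(t)|^{V_j} ≤ exp(−(κ v/2) t²) + 5B/(1 + t²)` with `κ = √2 (2/3 − π²/20)/(4√π)` and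
`B = e^{−1}/((v/2) log(5/3))`. -/
theorem abs_charFun_pow_le_majorant {β : ℕ → ℝ} {V : ℕ → ℕ} {v : ℝ} (hv0 : 0 < v)
    (hβ : Tendsto β atTop atTop) (hv : Tendsto (fun j => (V j : ℝ) / β j) atTop (𝓝 v)) :
    ∀ᶠ j in atTop, ∀ t : ℝ,
      |(∫ x in (-π)..π, Real.cos (t * x) * Real.exp (β j * Real.cos x)) /
          (∫ x in (-π)..π, Real.exp (β j * Real.cos x))| ^ V j ≤
        Real.exp (-(Real.sqrt 2 * (2 / 3 - π ^ 2 / 20) / (4 * Real.sqrt π) * (v / 2)) * t ^ 2) +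
          5 * (Real.exp (-1) / (v / 2 * Real.log (5 / 3))) / (1 + t ^ 2) := by
  set κ := Real.sqrt 2 * (2 / 3 - π ^ 2 / 20) / (4 * Real.sqrt π) with hκ
  set B := Real.exp (-1) / (v / 2 * Real.log (5 / 3)) with hB
  have hκ0 : 0 ≤ κ := le_trans (by norm_num) kappa_ge
  have hB0 : 0 ≤ B := by
    have := Real.log_pos (by norm_num : (1 : ℝ) < 5 / 3)
    positivity
  filter_upwards [eventually_continuumLimit_bounds hv0 hβ hv, hβ.eventually_ge_atTop 1] with j hj hj1 t
  obtain ⟨hj0, hlo, -, h2⟩ := hj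
  have hs : 1 ≤ Real.sqrt (β j) := Real.one_le_sqrt.2 hj1
  rcases le_or_gt |t| (2 * Real.sqrt (β j)) with ht | ht
  · -- window
    have hw := abs_charFun_pow_le_window hj1 ht (V j)
    rw [← hκ] at hw
    refine hw.trans ?_
    have hsecond : 0 ≤ 5 * B / (1 + t ^ 2) := by positivity
    refine le_trans (Real.exp_le_exp.2 ?_) (le_add_of_nonneg_right hsecond)
    -- `κ (v/2) t² ≤ κ V t²/β`
    have : v / 2 * t ^ 2 ≤ (V j : ℝ) * t ^ 2 / β j := by
      rw [le_div_iff₀ hj0]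
      nlinarith [mul_le_mul_of_nonneg_right hlo (sq_nonneg t)]
    have := mul_le_mul_of_nonneg_left this hκ0
    have e1 : κ * ((V j : ℝ) * t ^ 2 / β j) = κ * V j * t ^ 2 / β j := by ring
    linarith
  · -- tail
    have hw := abs_charFun_pow_le_tail hj1 ht.le h2
    refine hw.trans ?_
    have hfirst : 0 ≤ Real.exp (-(κ * (v / 2)) * t ^ 2) := (Real.exp_pos _).le
    refine le_trans ?_ (le_add_of_nonneg_left hfirst)
    have ht2 : 4 ≤ t ^ 2 := by
      have h4 : 2 ≤ |t| := by linarith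
      nlinarith [sq_abs t, abs_nonneg t]
    have ht0 : 0 < t ^ 2 := by linarith
    obtain ⟨m, hm⟩ := Nat.exists_eq_add_of_le' h2
    have hpow : (β j) * (3 / 5 : ℝ) ^ V j ≤ B := mul_pow_three_fifths_le hv0 hj0.le hlo
    rw [hm, show m + 2 - 2 = m from by omega]
    rw [hm] at hpow
    -- `(36/25)(β/t²)(3/5)^m = 4 β (3/5)^{m+2}/t² ≤ 4B/t² ≤ 5B/(1+t²)`
    have e : 36 / 25 * (β j / t ^ 2) * (3 / 5 : ℝ) ^ m = 4 * (β j * (3 / 5 : ℝ) ^ (m + 2)) / t ^ 2 := by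
      rw [pow_add]; field_simp; ring
    rw [e, div_le_div_iff₀ ht0 (by positivity)]
    nlinarith [hpow, hB0]

/-- The majorant is integrable. -/
theorem integrable_majorant {v : ℝ} (hv0 : 0 < v) :
    Integrable fun t : ℝ =>
      Real.exp (-(Real.sqrt 2 * (2 / 3 - π ^ 2 / 20) / (4 * Real.sqrt π) * (v / 2)) * t ^ 2) +
        5 * (Real.exp (-1) / (v / 2 * Real.log (5 / 3))) / (1 + t ^ 2) := by
  have hκ : 0 < Real.sqrt 2 * (2 / 3 - π ^ 2 / 20) / (4 * Real.sqrt π) * (v / 2) :=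
    mul_pos (lt_of_lt_of_le (by norm_num) kappa_ge) (by positivity)
  refine (integrable_exp_neg_mul_sq hκ).add ?_
  have h := integrable_inv_one_add_sq.const_mul (5 * (Real.exp (-1) / (v / 2 * Real.log (5 / 3))))
  refine h.congr (Eventually.of_forall fun t => ?_)
  simp only [div_eq_mul_inv]

/-! ### 3. Dominated convergence -/

/-- `t ↦ C_β(t) = ∫_{−π}^{π} cos(tx) e^{β cos x} dx` is continuous. -/
theorem continuous_integral_cos_mul_mul_exp (β : ℝ) :
    Continuous fun t : ℝ => ∫ x in (-π)..π, Real.cos (t * x) * Real.exp (β * Real.cos x) :=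
  intervalIntegral.continuous_parametric_intervalIntegral_of_continuous (a₀ := -π)
    (by fun_prop : Continuous (Function.uncurry fun (t x : ℝ) => Real.cos (t * x) * Real.exp (β * Real.cos x)))
    continuous_const

/-- **THE LOCAL LIMIT THEOREM (Fourier side).**  For `β_j → ∞`, `V_j/β_j → v > 0` and every `k ∈ ℤ`,
`∫_ℝ e^{−it·2πk} φ_{β_j}(t)^{V_j} dt → ∫_ℝ e^{−it·2πk} e^{−v t²/2} dt`. -/
theorem tendsto_integral_cexp_mul_charFun_pow {β : ℕ → ℝ} {V : ℕ → ℕ} {v : ℝ} (hv0 : 0 < v)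
    (hβ : Tendsto β atTop atTop) (hv : Tendsto (fun j => (V j : ℝ) / β j) atTop (𝓝 v)) (k : ℤ) :
    Tendsto (fun j => ∫ t : ℝ, cexp (-(↑(t * (2 * π * k)) * I)) *
        (((∫ x in (-π)..π, Real.cos (t * x) * Real.exp (β j * Real.cos x)) /
          (∫ x in (-π)..π, Real.exp (β j * Real.cos x))) ^ V j : ℝ)) atTop
      (𝓝 (∫ t : ℝ, cexp (-(↑(t * (2 * π * k)) * I)) * (Real.exp (-(v * t ^ 2 / 2)) : ℝ))) := by
  have hphase : ∀ t : ℝ, ‖cexp (-(↑(t * (2 * π * k)) * I))‖ = 1 := fun t => by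
    rw [show -(↑(t * (2 * π * (k : ℝ))) * I) = ((-(t * (2 * π * k)) : ℝ) : ℂ) * I by push_cast; ring]
    exact Complex.norm_exp_ofReal_mul_I _
  refine tendsto_integral_filter_of_dominated_convergence _ ?_ ?_ (integrable_majorant hv0) ?_
  · refine Eventually.of_forall fun j => Continuous.aestronglyMeasurable ?_
    refine Continuous.mul (by fun_prop) (continuous_ofReal.comp ?_)
    exact ((continuous_integral_cos_mul_mul_exp (β j)).div_const _).pow _
  · filter_upwards [abs_charFun_pow_le_majorant hv0 hβ hv] with j hj
    refine Eventually.of_forall fun t => ?_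
    rw [norm_mul, hphase t, one_mul, Complex.norm_real, Real.norm_eq_abs, abs_pow]
    exact hj t
  · refine Eventually.of_forall fun t => ?_
    exact ((continuous_ofReal.tendsto _).comp (tendsto_charFun_pow hβ hv t)).const_mul _

/-! ### 4. The Gaussian integral -/

/-- **`∫_ℝ e^{−it·2πk} e^{−v t²/2} dt = √(2π/v) e^{−2π²k²/v}`** (`v > 0`; Mathlib's
`fourier_gaussian_pi` at `b = v/(2π)`). -/
theorem integral_cexp_mul_gaussian_eq {v : ℝ} (hv0 : 0 < v) (k : ℤ) :
    ∫ t : ℝ, cexp (-(↑(t * (2 * π * k)) * I)) * (Real.exp (-(v * t ^ 2 / 2)) : ℝ) =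
      ((Real.sqrt (2 * π / v) * Real.exp (-(2 * π ^ 2 * (k : ℝ) ^ 2 / v)) : ℝ) : ℂ) := by
  have hπ : 0 < π := Real.pi_pos
  set b : ℂ := ((v / (2 * π) : ℝ) : ℂ) with hb
  have hbre : 0 < b.re := by rw [hb, Complex.ofReal_re]; positivity
  have hF := congr_fun (fourier_gaussian_pi hbre) (k : ℝ)
  rw [Real.fourier_real_eq_integral_exp_smul] at hF
  -- match the integrands
  have hint : ∫ t : ℝ, cexp (-(↑(t * (2 * π * k)) * I)) * (Real.exp (-(v * t ^ 2 / 2)) : ℝ) =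
      ∫ t : ℝ, cexp (↑(-2 * π * t * (k : ℝ)) * I) • cexp (-↑π * b * (t : ℂ) ^ 2) := by
    refine integral_congr_ae (Eventually.of_forall fun t => ?_)
    simp only [smul_eq_mul]
    congr 1
    · congr 1; push_cast; ring
    · rw [Complex.ofReal_exp]; congr 1; rw [hb]; push_cast; field_simp
  rw [hint, hF]
  -- evaluate the right-hand side
  have hb' : b = ((v / (2 * π) : ℝ) : ℂ) := hb
  have hvpos : 0 < v / (2 * π) := by positivity
  rw [hb', show (1 / 2 : ℂ) = ((1 / 2 : ℝ) : ℂ) by push_cast; ring, ← Complex.ofReal_cpow hvpos.le,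
    ← Real.sqrt_eq_rpow]
  have e1 : -↑π / ((v / (2 * π) : ℝ) : ℂ) * ((k : ℝ) : ℂ) ^ 2 = ((-(2 * π ^ 2 * (k : ℝ) ^ 2 / v) : ℝ) : ℂ) := by
    push_cast
    field_simp
  rw [e1, ← Complex.ofReal_exp, one_div, ← Complex.ofReal_inv, ← Real.sqrt_inv, inv_div]
  push_cast
  ring

end Summit.Ventures.LatticeQCDFlow.Scoring
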